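import Mathlib

/-!
# AppA (2-descent identities) of `proofs/AppA_descent_lead.md`, machine-checked as field identities (seat p2)

Curve in translated coordinates (`e_i = 0`): `y² = x (x − ej) (x − ek) = x³ + a x² + b x`, `a = −(ej+ek)`, `b = ej·ek`.
For `Q = (x0, y0)` with `y0 ≠ 0`: tangent slope `λ = (3x0² + 2a x0 + b)/(2y0)`, `x(2Q) = λ² − a − 2x0`, and
`r(Q) := (x0² − b)/(2 y0)`.

* `A1_duplication` : `x(2Q) = r(Q)²`  (AppA A1: `x(2Q) − e_i = r_i(Q)²`).
* `A2_translate_Ti` : with `Q + T_i = (b/x0, −b y0/x0²)`:  `r(Q+T_i) = r(Q)`.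
* `A2_translate_Tj` : with `Q + T_j = (x1, y1)`, `x1 = ej (x0 − ek)/(x0 − ej)`, `y1 = −y0 ej (ej − ek)/(x0 − ej)²`: `r(Q+T_j) = −r(Q)`,
  together with `onCurve_Tj` : `(x1, y1)` lies on the curve, and `collinear_Tj` : `(x1, −y1)` lies on the line through `T_j = (ej,0)` and `Q`
  (so `(x1, y1)` is indeed `Q + T_j` by the chord law).
-/

namespace ManinGammaPub0.P2

variable {K : Type*} [Field K]

/-- AppA A1 (duplication): `x(2Q) − e_i = r_i(Q)²` in translated coordinates. -/
theorem A1_duplication (ej ek x0 y0 : K) (h2 : (2 : K) ≠ 0) (hy : y0 ≠ 0)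
    (hc : y0 ^ 2 = x0 * (x0 - ej) * (x0 - ek)) :
    ((3 * x0 ^ 2 + 2 * (-(ej + ek)) * x0 + ej * ek) / (2 * y0)) ^ 2 - (-(ej + ek)) - 2 * x0
      = ((x0 ^ 2 - ej * ek) / (2 * y0)) ^ 2 := by
  have h2y : 2 * y0 ≠ 0 := mul_ne_zero h2 hy
  field_simp
  linear_combination (-(4 : K) * (-(ej + ek) + 2 * x0)) * hc

/-- AppA A2, translation by `T_i = (0,0)`: `Q + T_i = (b/x0, −b y0/x0²)` has the same `r`-value (pure identity; needs `ej, ek, x0, y0 ≠ 0`). -/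
theorem A2_translate_Ti (ej ek x0 y0 : K) (hy : y0 ≠ 0) (hx : x0 ≠ 0) (hj : ej ≠ 0) (hk : ek ≠ 0) :
    ((ej * ek / x0) ^ 2 - ej * ek) / (2 * (-(ej * ek) * y0 / x0 ^ 2)) = (x0 ^ 2 - ej * ek) / (2 * y0) := by
  have : -(ej * ek) * y0 ≠ 0 := mul_ne_zero (neg_ne_zero.mpr (mul_ne_zero hj hk)) hy
  field_simp
  ring

/-- The point `(x1, y1)` claimed to be `Q + T_j` lies on the curve. -/
theorem onCurve_Tj (ej ek x0 y0 : K) (hxj : x0 - ej ≠ 0)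
    (hc : y0 ^ 2 = x0 * (x0 - ej) * (x0 - ek)) :
    (-(y0 * ej * (ej - ek)) / (x0 - ej) ^ 2) ^ 2
      = (ej * (x0 - ek) / (x0 - ej)) * (ej * (x0 - ek) / (x0 - ej) - ej) * (ej * (x0 - ek) / (x0 - ej) - ek) := by
  rw [show (-(y0 * ej * (ej - ek)) / (x0 - ej) ^ 2) ^ 2 = y0 ^ 2 * ((ej * (ej - ek)) ^ 2 / ((x0 - ej) ^ 2) ^ 2) by
        field_simp, hc]
  field_simp
  ring

/-- `(x1, −y1)` (the third intersection point) is collinear with `T_j = (ej, 0)` and `Q = (x0, y0)`: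
slope from `T_j` to it equals slope from `T_j` to `Q`. -/
theorem collinear_Tj (ej ek x0 y0 : K) (hxj : x0 - ej ≠ 0) :
    (y0 * ej * (ej - ek) / (x0 - ej) ^ 2) * (x0 - ej) = y0 * (ej * (x0 - ek) / (x0 - ej) - ej) := by
  field_simp
  ring

/-- AppA A2, translation by `T_j = (ej, 0)`: `r(Q + T_j) = − r(Q)`. -/
theorem A2_translate_Tj (ej ek x0 y0 : K) (h2 : (2 : K) ≠ 0) (hy : y0 ≠ 0) (hxj : x0 - ej ≠ 0)
    (hj : ej ≠ 0) (hjk : ej - ek ≠ 0) :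
    ((ej * (x0 - ek) / (x0 - ej)) ^ 2 - ej * ek) / (2 * (-(y0 * ej * (ej - ek)) / (x0 - ej) ^ 2))
      = -((x0 ^ 2 - ej * ek) / (2 * y0)) := by
  have hden : -(y0 * ej * (ej - ek)) ≠ 0 := by
    apply neg_ne_zero.mpr; exact mul_ne_zero (mul_ne_zero hy hj) hjk
  field_simp
  ring

end ManinGammaPub0.P2
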